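import Mathlib
import HarnessLib
import HarnessLib.Audit
import Summits.SmoothPoincare4.Statement
import Literature.Geometry.Riemannian.CurvatureDecomposition
import Literature.Topology.FourManifolds.SmoothOrientation
import Literature.Topology.FourManifolds.ComplexProjectiveSpace
import Literature.Topology.FourManifolds.QuaternionicRealStructure
import Literature.Geometry.Symplectic.AlmostComplexStructure
import Literature.Geometry.Kaehler.FubiniStudyProjectiveSpace
import Literature.Geometry.Riemannian.TwistorPackage
import Literature.Geometry.Riemannian.TwistorPackageProofs
import HarnessLib.Audit.Status.Attr

/-!
Route: TwistorRealLines

DORMANT since 2026-08-22T15:51:06Z (reconciler: no traction for 5.5 d (last activity item-evidence-added at 2026-08-17T04:14:33Z); parked, not closed — `ledger route dormant route-SmoothPoincare4-TwistorRealLines --off` to reactivate) — unstaffed, not closed; items shared with open routes are served there. `ledger route dormant <id> --off` reactivates.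

# Route TwistorRealLines — SPC4 as rigidity of τ-real pseudo-holomorphic line congruences in ℂP³ —
positive twistor-symplectic metrics on homotopy 4-spheres exist and force S⁴

Realises idea card SmoothPoincare4/SmoothPoincare4/twistor-real-lines-cp3 (spine). It suffices to
show X = E ∧ R.
E (item TwistorSymplecticExistence): every smooth homotopy 4-sphere M carries a smooth orientation o
and a Riemannian metric g of POSITIVE TWISTOR-SYMPLECTIC (positive-definite) TYPE: at every point
and every o-positive g-orthonormal frame e, Hamilton's curvature blocks A = (R(φᵢ,φⱼ)) (the Λ⁺Λ⁺
block, ∝ W⁺ + s/12) and B = (R(φᵢ,ψⱼ)) (the Λ⁺Λ⁻ block, ∝ Ric₀ : Λ⁺ → Λ⁻) satisfy |Bᵀu| < |Au| and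
uᵀAu > 0 for all u ≠ 0 — verbatim the hypothesis of Fine–Krasnov–Panov Thm 20 + Conj 21, ((s/12 +
W⁺)² > Ric₀*Ric₀ with s/12 + W⁺ > 0): the Levi-Civita connection on Λ⁺ is a POSITIVE DEFINITE
connection and Reznikov's closed coupling 2-form ω_g on the twistor space Z(M,g) = S(Λ⁺) is
symplectic of Fano sign.
R (item TwistorSymplecticRigidity): a smooth homotopy 4-sphere carrying such (o, g) is diffeomorphic
to S⁴ (= FKP Conjecture 21 restricted to homotopy spheres, where ℂP̄² is excluded).
The card's ENGINE for R is carried by two further cruxes: RealCongruenceRigidity (rank 2; filed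
informally at open, TYPED at rev 1–3 over Literature's AlmostComplexStructure / IsTamedBy,
fubiniStudyMFormCP and QuaternionicRealStructure, with connected fibres ≃ₜ S²) — a smooth fibration
of ℂP³ by τ₀-invariant J-holomorphic spheres, J ω_FS-tame and τ₀-real, has leaf space diffeomorphic
to S⁴ (push the congruence along a wall-free path of real tame J to the quaternionic congruence ℂP³
→ ℍP¹; a parametrised real-line moduli space without critical points is a proper submersion over
[0,1]); TwistorToStandard (rank 5; informal until the twistor-space vocabulary lands as the
hypothesis package defn-TwistorPackage) — the real symplectic twistor space (Z(M,g), ω_g, τ_g) of a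
positive-type homotopy sphere is equivariantly symplectomorphic, up to scale, to (ℂP³, ω_FS, τ₀)
(its smooth half, (Z(M), τ_g) ≅ (ℂP³, τ₀) equivariantly for every metric, is recorded by the route
review as known via the h-cobordism M ∼ S⁴; the live content is the symplectic half, FKP Conj 19 ∘
τ-equivariance). Typed support records the card's step 1: TwistorLift (M is the base of a smooth
S²-fibration of ℂP³), SphereFibrationBase (any such base is a homotopy 4-sphere),
FibrationReformulation (hence SPC4 ⟺ "every smooth S²-fibration of ℂP³ has base diffeomorphic to
S⁴").
Lean: `(∀ (M : Type) [TopologicalSpace M] [T2Space M] [SecondCountableTopology M] [ChartedSpace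
(EuclideanSpace ℝ (Fin 4)) M] [IsManifold (𝓡 4) ∞ M], M ≃ₕ (Metric.sphere (0 : EuclideanSpace ℝ (Fin
5)) 1) → ∃ (o : Literature.Topology.FourManifolds.SmoothOrientation (𝓡 4) M) (g :
Literature.Geometry.Lorentzian.PseudoRiemannianMetric (𝓡 4) ∞ (EuclideanSpace ℝ (Fin 4))
(TangentSpace (𝓡 4) : M → Type _)), ∃ _ : g.HasLeviCivita, g.IsRiemannian ∧ ∀ (x : M) (e : Fin 4 →
TangentSpace (𝓡 4) x), g.IsOrthonormalFrame x e → 0 < Module.Ray.someVector (o x) (fun i => e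
(Fin.cast finrank_euclideanSpace_fin i)) → ∀ u : Fin 3 → ℝ, u ≠ 0 → dotProduct (Matrix.vecMul u
(g.blockB g.leviCivita x e)) (Matrix.vecMul u (g.blockB g.leviCivita x e)) < dotProduct
(Matrix.mulVec (g.blockA g.leviCivita x e) u) (Matrix.mulVec (g.blockA g.leviCivita x e) u) ∧ 0 <
dotProduct u (Matrix.mulVec (g.blockA g.leviCivita x e) u)) ∧ (∀ (M : Type) [TopologicalSpace M]
[T2Space M] [SecondCountableTopology M] [ChartedSpace (EuclideanSpace ℝ (Fin 4)) M] [IsManifold (𝓡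
4) ∞ M], M ≃ₕ (Metric.sphere (0 : EuclideanSpace ℝ (Fin 5)) 1) → (∃ (o :
Literature.Topology.FourManifolds.SmoothOrientation (𝓡 4) M) (g :
Literature.Geometry.Lorentzian.PseudoRiemannianMetric (𝓡 4) ∞ (EuclideanSpace ℝ (Fin 4))
(TangentSpace (𝓡 4) : M → Type _)), ∃ _ : g.HasLeviCivita, g.IsRiemannian ∧ ∀ (x : M) (e : Fin 4 →
TangentSpace (𝓡 4) x), g.IsOrthonormalFrame x e → 0 < Module.Ray.someVector (o x) (fun i => e
(Fin.cast finrank_euclideanSpace_fin i)) → ∀ u : Fin 3 → ℝ, u ≠ 0 → dotProduct (Matrix.vecMul u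
(g.blockB g.leviCivita x e)) (Matrix.vecMul u (g.blockB g.leviCivita x e)) < dotProduct
(Matrix.mulVec (g.blockA g.leviCivita x e) u) (Matrix.mulVec (g.blockA g.leviCivita x e) u) ∧ 0 <
dotProduct u (Matrix.mulVec (g.blockA g.leviCivita x e) u)) → Nonempty (M ≃ₘ⟮𝓡 4, 𝓡 4⟯
(Metric.sphere (0 : EuclideanSpace ℝ (Fin 5)) 1)))`

## Assembly
Pure logic: SmoothPoincare4 unfolds to ∀ M (T2, 2nd countable) (ℝ⁴-charted, C^∞), M ≃ₕ S⁴ → Nonempty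
(M ≃ₘ S⁴); given such M and e : M ≃ₕ S⁴, TwistorSymplecticExistence supplies (o, g) of positive type
and TwistorSymplecticRigidity returns the diffeomorphism (Sketch.lean `assembly_provable :
Assembly`, two lines: `intro hR hE M _ _ _ _ _ he; exact hR M he (hE M he)`). The statements use the
summit's own binders, so no packaging fact (compactness/orientability of homotopy 4-spheres) enters.

Rationale: WHY THIS LINE. Mechanism (card twistor-real-lines-cp3): the twistor space of any homotopy 4-sphere
is DIFFEOMORPHIC to ℂP³ (Wall1966, or the S²-bundle over the Kervaire–Milnor h-cobordism plus
Smale), so SPC4 becomes a statement about sphere-fibrations of one fixed, maximally rigid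
6-manifold; a positive-definite-type metric (Reznikov1993, FinePanov2009, FineKrasnovPanov2014 Thm
20) upgrades the twistor fibration to a congruence of τ-real pseudo-holomorphic LINES in a monotone
real symplectic ℂP³, and S⁴ = ℍP¹ is the congruence of real lines of the quaternionic structure —
"an exotic 4-sphere would be an exotic real form of the line geometry of ℂP³". Imported areas:
twistor theory (AtiyahHitchinSinger1978, Hitchin1981 = the integrable stratum), symplectic topology
of twistor spaces (Reznikov1993, FinePanov2009, Fine2017, Evans2014), real enumerative / real
Gromov–Witten theory of (ℂP³, τ₀) (Welschinger2005, BrugalleGeorgieva2016, GeorgievaZinger2018) and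
Fredholm theory of J-curves (Gromov1985, HoferLizanSikorav1997, McDuffSalamon2012), whose regular
parametrised moduli spaces output DIFFEOMORPHISMS of parameter spaces with no h-cobordism or handle
argument. The typed spine E ∧ R is FKP's "gauge-theoretic sphere conjecture" in its Riemannian form
(Conj 21) pointed at homotopy spheres — in print, never aimed at SPC4 (FKP mention neither homotopy
spheres nor exotic structures); what is new is the engine (real lines instead of FKP's variational
Conj 24, the route of sibling card definite-connection-volume-ceiling) and the smooth reformulation
through S²-fibrations of ℂP³. No prior route of this summit uses twistor spaces, ℂP³ or
pseudo-holomorphic curves (PIC's crux PicConformallyFlatV2 is the integrable shadow: W ≡ 0);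
negatives index empty.

RANKED CRUXES. Four cruxes after the rev-4 re-badge (ranks 2, 3, 4, 5; the deciding theorem `closes`
consumes ranks 3 and 4, ranks 2 and 5 are the ENGINE foreseen as the glued split of rank 4). rank 2
· RealCongruenceRigidity · crux — filed informally at open and TYPED 2026-08-15 (grounder g18-28,
`set-signature`) once definition requests D1–D3 landed
(Literature.Geometry.Symplectic.AlmostComplexStructure with IsTamedBy,
Literature.Geometry.Kaehler.fubiniStudyMFormCP,
Literature.Topology.FourManifolds.QuaternionicRealStructure; the three imports were added at rev 1):
for J a smooth ω_FS-tame almost complex structure on ℂP³ with dτ₀∘J = −J∘dτ₀ (τ₀ :=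
QuaternionicRealStructure 1, its smoothness an explicit hypothesis) and p : ℂP³ → B a smooth
surjective submersion onto a 4-manifold with p∘τ₀ = p whose fibres are J-complex AND homeomorphic to
S² (the connected-fibre clause demanded by the route review — without it ℂP³ → S⁴ → ℝP⁴ satisfies
every hypothesis with base ℝP⁴, Objection-RealCongruenceRigidity.md; 'in the line class' is then
automatic and omitted), B ≅ S⁴ (why it might fail: regularity of real lines is not automatic in
dimension 6 and walls have codimension one among real tame J, so a wall-free path to J₀ need not
exist; even at J₀ print has the base only up to homeomorphism — Yang 1981 / GluckWarnerYang1983, cf.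
route QuaternionicSimilarity's crux GreatFibrationBaseStandard, of which the J₀ case is a sub-case;
sources Gromov1985, HoferLizanSikorav1997, Welschinger2005, GeorgievaZinger2018,
BrugalleGeorgieva2016, Hitchin1981, Fine2017, GluckWarnerYang1983); the duplicate filing of this
crux (stmt-SmoothPoincare4-6978, a race between the opener and the first repair unit) was dropped at
rev 3. rank 5 · TwistorToStandard · crux (re-badged from support at rev 4; INFORMAL — no Lean
signature until the twistor-space vocabulary lands, see DEFINITION REQUESTS) — for (M,o,g) of
positive type with M ≃ₕ S⁴, (Z(M,g), ω_g, τ_g) ≅ (ℂP³, c·ω_FS, τ₀) equivariantly (why it might fail: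
contains the open half of FKP Conj 19, uniqueness of the symplectic form on ℂP³ in the class
c[ω_FS], plus τ-equivariance; a positive-type metric on S⁴ itself with non-standard (Z, ω_g, τ_g)
refutes it without touching SPC4; sources FineKrasnovPanov2014 Conj 19, FinePanov2009, Reznikov1993,
Wall1966, McDuffSalamon2017). Route-review sharpening on file (Note-TwistorToStandard.md, refuter's
claim, not verified in tree): the SMOOTH half — (Z(M), τ_g) ≅ (ℂP³, τ₀) τ-equivariantly — holds for
every homotopy 4-sphere and every metric (extend Λ⁺ over the h-cobordism M ∼ S⁴ and projectivise: a
7-dimensional h-cobordism between Z(M)/τ_g and ℂP³/τ₀ with π₁ = ℤ/2, Wh(ℤ/2) = 0, s-cobordism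
theorem, lift to double covers), so the live content is the SYMPLECTIC half (equivariant uniqueness
of monotone Reznikov forms in the class c[ω_FS]); when the item is typed the tenure planner should
consider typing that reduced form. The typed items:
#0 Target (target) — X = E ∧ R: every smooth homotopy 4-sphere admits an orientation and a
Riemannian metric of positive twistor-symplectic type (framewise FKP inequality |Bᵀu| < |Au|, uᵀAu >
0 on o-positive orthonormal frames), and every smooth homotopy 4-sphere admitting one is
diffeomorphic to S⁴. (why it might fail: E ⇔ SPC4 modulo FKP Conj 21 and R has no slack beyond SPC4;
as a programme it stalls if real walls in ℂP³ are unavoidable (rank 2) or if Reznikov forms on ℂP³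
are not standard (rank 5).) [FineKrasnovPanov2014, Reznikov1993, FinePanov2009, Hitchin1981]
#3 TwistorSymplecticExistence (crux) — card item T1, in FKP's Riemannian form: for every smooth
4-manifold M (T2, second countable, ℝ⁴-charted, C^∞) homotopy equivalent to S⁴ there are a smooth
orientation o and a Riemannian metric g with Levi-Civita connection such that at every point x, for
every g-orthonormal frame e that is o-positive (some representative 4-form of o(x) is positive on e)
and every u ∈ ℝ³ ∖ 0, |u ᵥ* blockB|² < |blockA *ᵥ u|² and uᵀ(blockA)u > 0 (Hamilton's blocks A_ij =
R(φᵢ,φⱼ), B_ij = R(φᵢ,ψⱼ) in the self-dual/anti-self-dual bases of e; frame-independent within the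
orientation class). Equivalently (s/12 + W⁺)² > Ric₀*Ric₀ and s/12 + W⁺ > 0: the Levi-Civita
connection on Λ⁺ is positive definite (FKP Thm 20), Z(M,g) is Reznikov-symplectic and Fano (FKP Prop
15). SPC4 ⇒ this (round metric: B = 0, A = (s/12)·c·Id > 0). [difficulty: open-problem] (why it
might fail: SPC4-complete mod FKP Conj 21 (an exotic Σ refutes it); s-dominated pointwise cone
(PSC-hard: KumarSen2025) on a closed Σ reached from S⁴ only by codim-2/3 surgery, where pointwise
curvature cones do not propagate (Hoelzel2016); no construction but a diffeomorphism is known.)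
[FineKrasnovPanov2014, Reznikov1993, FinePanov2009, Fine2017, Hoelzel2016, KumarSen2025]
#4 TwistorSymplecticRigidity (crux) — FKP Conjecture 21 restricted to homotopy spheres (card: T2 ∧
T3 ∧ dictionary, umbrella form): every smooth 4-manifold M homotopy equivalent to S⁴ that carries an
orientation o and a Riemannian metric g of positive twistor-symplectic type (same framewise
inequality as TwistorSymplecticExistence) is diffeomorphic to S⁴. Intended proof = the route's
engine: TwistorToStandard → RealCongruenceRigidity (foreseen glued split); alternative engine = FKP
Conj 24 (sibling card definite-connection-volume-ceiling). Known strata: Einstein (FKP Thm 22 via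
Gursky + Hitchin1981), anti-self-dual (Hitchin1981), Fubini–Study-Riemannian-submersion twistor
fibrations (Gromoll–Grove). [difficulty: open-problem] (why it might fail: No slack: with Conj 19/21
it IS SPC4 on such Σ; engines are FKP's variational Conj 24 (no compactness for definite
connections) or this route's real-line path, whose walls (obstructed τ-real lines, codimension 1
among real tame J) may be unavoidable in dimension 6.) [FineKrasnovPanov2014, Hitchin1981,
Gromov1985, HoferLizanSikorav1997, Fine2017, Welschinger2005]
#9 TwistorLift (support) — card step 1 (LIFT): every smooth 4-manifold M homotopy equivalent to S⁴
is the base of a smooth S²-fibration of ℂP³ — there is a smooth surjective submersion p :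
ComplexProjectiveSpace 3 → M (Literature's ℂP³, model 𝓡 (2·3)) all of whose fibres are homeomorphic
to S². Proof route: the twistor fibration S(Λ⁺M) → M of any metric composed with a diffeomorphism
S(Λ⁺M) ≅ ℂP³, from Wall1966 (closed 1-connected spin 6-manifolds with torsion-free homology are
classified by H², the cubic form and p₁: here ℤx, x³ = 1, p₁ = 4x², b₃ = 0) or from the S²-bundle
over the h-cobordism Σ ∼ S⁴ (tree facts isHCobordant_sphere_of_homotopySphere_four,
nonempty_diffeomorph_of_isHCobordant_of_five_le in dimension 6). SPC4 ⇒ this trivially (ℂP³ → ℍP¹ =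
S⁴ ≅ M). [difficulty: L] [Wall1966, AtiyahHitchinSinger1978, KervaireMilnor1963,
MilnorHCobordism1965]
#9 SphereFibrationBase (support) — converse bookkeeping of step 1: if p : ComplexProjectiveSpace 3 →
B is a smooth surjective submersion onto a smooth 4-manifold B (T2, second countable) with fibres
homeomorphic to S², then B ≃ₕ S⁴ (B is compact as an image; Ehresmann ⇒ fibre bundle; LES ⇒ π₁B = 1;
χ(B) = χ(ℂP³)/χ(S²) = 2 ⇒ H₂B = 0; Hurewicz + Whitehead). Makes RealCongruenceRigidity's conclusion
meaningful for SPC4 and shows every positive item of the route is implied by SPC4. [difficulty: L]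
[Hatcher2002, Whitehead1949, MilnorStasheff1974, Besse1987]
#9 FibrationReformulation (support) — the card's reformulation, as glue over the two supports:
TwistorLift → SphereFibrationBase → (("every smooth S²-fibration p : ℂP³ → B over a smooth
4-manifold has B ≅ S⁴") ↔ SmoothPoincare4). Pure logic (proved sorry-free in the planner's
Sketch.lean, `fibrationReformulation_provable`). [difficulty: provable-now] [Wall1966, Hitchin1981]

TWO-LAYER PLAN. Foreseen glued splits (nothing filed now beyond the two informal engine cruxes):
TwistorSymplecticRigidity ⇐ TwistorToStandard → RealCongruenceRigidity → TwistorSymplecticRigidity,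
glue = the dictionary (FKP Thm 20 / FinePanov2009 Lemma: ω_g symplectic, fibres symplectic spheres,
τ_g free anti-symplectic; elementary: an ω-compatible τ-anti-invariant J preserving the vertical
bundle exists; SphereFibrationBase). RealCongruenceRigidity ⇐ (ModelTransversal: the quaternionic
congruence ℍP¹ ⊂ M_R(J₀) is cut out transversally — normal bundle O(1)⊕O(1), real index 4) →
(FibredChamberConnected: within real tame J admitting a real-line fibration, the Fredholm-regular
ones are path-connected, or every wall crossing between fibred chambers is a diffeomorphically
trivial surgery) → RealCongruenceRigidity, glue = Gromov compactness in the minimal class +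
Ehresmann over [0,1]. TwistorSymplecticExistence ⇐ (Gluck-twist test family: positive-type metrics
on Gluck twists, cf. PIC's PicGluckV2) → (isometric cork-regluing transport, cf. WeylBudget) — k ≤ 3
each, depth 1.

KILL CRITERIA. Every positive item here is implied by SPC4, so a REFUTATION of
TwistorSymplecticExistence, TwistorSymplecticRigidity, RealCongruenceRigidity or any support item
exhibits an exotic 4-sphere (close refuted:<Decl>; the witness — a curvature obstruction carried by
exotica, or a real J-line congruence of ℂP³ with non-standard leaf space — is itself the prize).
Route-specific kills that leave SPC4 open: (i) TwistorToStandard refuted (a positive-type metric,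
even on S⁴, whose Reznikov form or antipodal involution is not standard on ℂP³) — pivot: run the
real-line argument inside (Z, ω_g, τ_g) along a path of tame real J ending at a structure pulled
back from the model by a mere diffeomorphism, i.e. replace rank 5 by 'fibred real chambers are
connected across real symplectic forms in the class of ω_FS'; (ii) a grounder shows
RealCongruenceRigidity needs hypotheses (smoothness of J, tameness) under which it is vacuous, or
that leaf spaces of real congruences are automatically S⁴ by an elementary argument (then rank 2
closes as support and the route collapses to E ∧ R = FKP Conj 21 — still open, but graded variant of
definite-connection-volume-ceiling: close superseded); (iii) FKP Conj 21 proved by the variational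
route (sibling card) moots the engine and closes R; (iv) an obstruction theorem 'no metric of
positive type on any Gluck twist ≠ S⁴-presentation' without deciding exoticity would make E unusable
as a programme — pivot to the negative reading (E's negation as an exotica detector).

NOT DECOMPOSED YET. The wall-crossing analysis of real lines (index-1 real walls, orientability of
real-line moduli via real-orientability of (ℂP³, τ₀), GeorgievaZinger2018) and the transversality of
the model congruence are layer-2 children of rank 2; the Ricci-dominated definite chamber (|Ric₀z| >
|(W⁺+s/12)z|, conformal class of the connection ≠ [g]) and the negative-definite sign (symplectic
Calabi–Yau twistor space — on a homotopy sphere it would put a c₁ = 0 symplectic form on ℂP³) are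
deliberately excluded from E; uniqueness of τ_g up to conjugacy, monotonicity/first-Chern-class
bookkeeping of (Z, ω_g) and the Moser/Gromov arguments inside TwistorToStandard are not split; the
vendoring of Wall1966 / Ehresmann / the fibration LES needed by the two L-support items is provers'
and grounders' business (cite items filed).

CHEAPEST FALSIFIER. (1) MODEL TRANSVERSALITY, a sheaf/linear-algebra computation refuters can do by
hand: for J₀ and a quaternionic line L ⊂ ℂP³, N_L = O(1)⊕O(1), the τ₀-real part of H⁰(N_L) is
4-dimensional and H¹(N_L) = 0, so M_R(J₀) = ℍP¹ is a transversally cut-out compact 4-manifold and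
the real evaluation map has degree 1 (one real line through z and τ₀z; BrugalleGeorgieva2016's
GW–Welschinger count of lines through a conjugate pair) — if this failed the engine would be dead at
t = 0. (2) LITERATURE: a classification of free involutions on ℂP³ acting as −1 on H² (surgery
theory; compare the fake ℝP⁴'s one dimension down,
Literature.Barriers.SmoothPoincare4.ProjectiveRigidityBarrierFour) showing non-standard conjugacy
classes inserts a smooth crux in front of rank 5. (3) SANITY already run: the round S¹×S³ is exactly
borderline for the definite cone (ℛφ = ½φ − ½ψ, |Az| = |Bᵀz|), consistent with FKP Conj 19 (no
compact example other than S⁴, ℂP̄²); refuters should test the cone on S²×S² and ℂP²#ℂP̄² metrics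
next (SmallExotica-type consistency of Conj 19).

NUMBERS. Cones (Λ⁺-blocks A ∝ W⁺ + s/12, B ∝ Ric₀; tr A = s/4 in the operator normalisation): tame
cone |⟨Aθ,θ⟩| > |Bθ||θ| (FinePanov2009 Thm 4.4, quoted in Fine2017 §1.1; det A > 0 ⇒ ω tames J₊) ⊂
definite cone |Aθ| > |Bθ| (FineKrasnovPanov2014 Thm 20; sign = sign det(s/12 + W⁺)); pointwise
2/5-pinched sectional curvature ⇒ tame (FinePanov2009 Rem 3.8); anti-self-dual Einstein s ≠ 0: B =
0, A = (s/12)Id. Lines in ℂP³: c₁[L] = 4, unparametrised moduli dimension 8 = dim_ℝ Gr₂(ℂ⁴), τ-real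
part 4, real walls of codimension 1, ⟨pt, pt⟩ line invariant 1. Twistor space of a homotopy
4-sphere: H² = ℤx, x³ = 1, w₂ = 0, p₁ = 4x², b₃ = 0, χ = 4 (= ℂP³'s invariants, Wall1966). FKP
volume bound for definite connections: (4π²/Λ²)p₁(E) < S(A) ≤ (12π²/Λ²)p₁(E), p₁ = 2χ + 3τ = 4 on a
homotopy sphere (FineKrasnovPanov2014 §2). Items at open: 7 typed (target, 2 cruxes, 3 support,
assembly) + 2 informal cruxes = 9 ≤ 15. After rev 4: 9 items — target, assembly, 4 cruxes
(RealCongruenceRigidity r2 typed, TwistorSymplecticExistence r3, TwistorSymplecticRigidity r4,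
TwistorToStandard r5 informal), 3 support (TwistorLift, SphereFibrationBase,
FibrationReformulation); import cone: 0 unproved project constants among 65 (the 13 undischarged
facts counted by the guardrail are the summit-wide SPC4Wave0 floor behind the mandatory Statement
import — needs-fact NONE, cone-diagnosis-TwistorRealLines.md).

DEFINITION REQUESTS. Filed after open (ledger workitem add --kind definition, --for the informal
cruxes): (D1) AlmostComplexStructure on a real manifold (smooth section J of End TM with J² = −1)
and ω-tameness, topic Literature/Geometry/Symplectic; (D2) the Fubini–Study symplectic form on
Literature's ComplexProjectiveSpace n as an MForm (𝓡 (2n)) — descend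
Literature.Geometry.Kaehler.fubiniStudyForm (already projectively invariant, FubiniStudy.lean)
through the affine charts, topic Literature/Geometry/Kaehler; (D3) the quaternionic real structure
τ₀ on ComplexProjectiveSpace (2k+1) (Projectivization.map of the conj-semilinear map v ↦ (−v̄₁, v̄₀,
−v̄₃, v̄₂, …)), free, anti-holomorphic, ω_FS-anti-symplectic, topic
Literature/Topology/FourManifolds; (D4) TwistorSpace of an oriented Riemannian 4-manifold (unit
sphere bundle of Λ⁺ as a smooth 6-manifold with projection, fibrewise antipodal involution, Reznikov
coupling 2-form, AHS structure J₊), topic Literature/Geometry/Riemannian. STATUS 2026-08-15 (rev 4):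
D1–D3 LANDED (defn-AlmostComplexStructure, defn-FubiniStudyMFormProjectiveSpace,
defn-QuaternionicRealStructure; smoothness and ω_FS-anti-symplecticity of τ₀ are still wished API,
hence explicit hypotheses in RealCongruenceRigidity); D4 defn-TwistorSpace is BLOCKED
(literature-prover g30-20: XL as a body-carrying construction — no bundle-level Λ⁺, no
sphere-bundle-as-manifold, no connection/curvature forms on Z in tree) and is RE-FILED as the
hypothesis package defn-TwistorPackage (CONVENTIONS §9): a structure of DATA (Z⁶, π, τ, ω) with the
structural axioms every metric satisfies, a characterisation predicate IsTwistorSpaceOf g o pinning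
(Z, π, τ, ω) down as S(Λ⁺M) with the antipodal map and the Reznikov/Fine–Panov coupling form
(vertical part = fibre area form, horizontal part ⟨F_∇, ζ⟩ with F_∇ = Hamilton's blocks (A, B) of
CurvatureDecomposition.lean), and ONE existence fact; TwistorToStandard is then typed over (P,
IsTwistorSpaceOf g o P) — NOT over bare packages, which would make it trivially false (degenerate
closed τ-anti-invariant ω exist). Cite facts wanted (kind cite): FKP Thm 20 + FinePanov2009 Lemma
(Reznikov form symplectic ⇔ definite; metric criterion and sign); Wall1966 classification ⇒ S(Λ⁺Σ) ≅
ℂP³ for a homotopy 4-sphere Σ; AtiyahHitchinSinger1978 (J₊, holomorphic fibres, antiholomorphic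
antipodal map) with Hitchin1981 (Kählerian twistor space ⇒ S⁴ or ℂP²); Ehresmann's fibration theorem
+ homotopy LES for SphereFibrationBase.

Novelty: Searches (2026-08-15): `lit frontier SmoothPoincare4 --since 2020` (30 rows:
census/trisection/cork/gauge-families items, no twistor or real-GW entry); `lit bridges
SmoothPoincare4 --cross any` (30 rows, none relevant); `lit search --source zbmath "fibrations of
spheres by great spheres"` (10: GluckWarnerYang1983 doi:10.1215/s0012-7094-83-05044-5, Yang 1981
doi:10.4310/jdg/1214436369, Gluck–Warner–Ziller 1986/1987); `lit search --source crossref "Reznikov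
symplectic twistor spaces"` (6: Reznikov1993 doi:10.1007/bf00773449, Fine2017
doi:10.1112/tlm3.12003, Vaisman 1986, Albuquerque 2008); `lit search --source crossref`
Brugallé–Georgieva (doi:10.1007/s00208-016-1398-x), Evans2014 (doi:10.4310/jdg/1395321845),
Welschinger2005 (doi:10.1215/s0012-7094-04-12713-7), Wall1966 (doi:10.1007/bf01389738); `lit search
--source zbmath "twistor space homotopy 4-sphere diffeomorphic CP^3"` (0); `lit galaxy search --star
all "twistor space of an exotic"` (0) and `"symplectic twistor space"` (0 — galaxy saturated, 79 s);
`lit read arxiv:1312.2831` pp.10–11 READ (Lemma 12, Rem 13, Prop 15, Conj 19, Thm 20, Conj 21, Thm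
22, Conj 24); `lit read arxiv:1602.03829` p.3 READ (FinePanov2009 Thm 4.4 tame inequality,
2/5-pinching, 'one can use J-holomorphic curves in (Z,ω) to study the Riemannian geometry of
(M,g)'); ledger idea list (138 cards; siblings definite-connection-volume-ceiling [variant],
cp3-sphere-fibrations-definite-connections and definite-connections-twistor-fano [retired into it],
twis  [refs: 10.1215/s0012-7094-83-05044-5, 10.4310/jdg/1214436369, 10.1007/bf00773449, 10.1112/tlm3.12003, 10.1007/s00208-016-1398-x, 10.4310/jdg/1395321845, 10.1215/s0012-7094-04-12713-7, 10.1007/bf01389738, 10.4310/jdg/1242134371, 10.1215/00127094-2017-0023, 1312.2831, 1602.03829, 1106.3959, doi:10.1215/s0012-7094-83-05044-5, doi:10.4310/jdg/1214436369, doi:10.1007/bf00773449, doi:10.1112/tlm3.12003, doi:10]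

Barriers (technique_class: twistor-lift, real-J-lines-CP3, submersion-rigidity): - technique_class: twistor-lift, real-J-lines-CP3, submersion-rigidity
- Literature.Barriers.SmoothPoincare4.TopologicalBarrierFour: not engaged — no homeomorphism
invariant of Σ is evaluated; the objects (a metric cone on Σ, a sphere-fibration of ℂP³, a real-line
moduli space) are smooth data and the output is a diffeomorphism produced by a submersion.
- Literature.Barriers.SmoothPoincare4.StableBarrierFour: evaded — nothing is stabilised by S²×S² or
ℂP²; the positive-type cone and the fibration datum do not survive connected sum, so no stable
invariant is implicitly computed (and any obstruction to E found on the negative side must be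
unstable, as pointwise cones are).
- Literature.Barriers.SmoothPoincare4.HCobordismInvariantBarrierFour: not engaged — Σ ∼_h S⁴ is USED
(TwistorLift's second proof) only to identify the 6-dimensional twistor spaces, where Smale's
theorem holds; no h-cobordism invariant of Σ is claimed to separate.
- Literature.Barriers.SmoothPoincare4.HCobordismBarrierFour: evaded in intent, conceded in risk —
the 5-dimensional parametrised real-line moduli space between ℍP¹ and Σ is trivialised by REGULARITY
(no critical points of the projection to [0,1]), never by handle cancellation; if real walls occur
it degenerates to a mere cobordism/h-cobordism, which this barrier says is worthless — that is
exactly why RealCongruenceRigidity is rank 2.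
- Literature.Barriers.SmoothPoincare4.GaugeSumBarrierFour: not applicable — no
Donaldson/Seiberg–Witten-type invarian

History (route lifecycle, newest last):
- 2026-08-15T16:21:13Z · rev 3: dropped stmt-SmoothPoincare4-6978 — route-repair step 3/3 (glue): deciding theorem closes : TwistorSymplecticRigidity → TwistorSymplecticExistence → SmoothPoincare4 (certified: ledger route check (planner-rbadge-SmoothPoincare4-TwistorRealLine-d095f5be-g2-0)
- 2026-08-22T15:51:06Z · DORMANT — reconciler: no traction for 5.5 d (last activity item-evidence-added at 2026-08-17T04:14:33Z); parked, not closed — `ledger route dormant route-SmoothPoincare4- (operator:999:421709)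

sub-problem: SmoothPoincare4 · status: dormant · opened planner-plancard-SmoothPoincare4-SmoothPoinca-eb33d47e-0 2026-08-15T11:40:47Z · rev 5 · ledger route-SmoothPoincare4-TwistorRealLines
GENERATED by the gate from the ledger (D-0016/17). Provers cite these decls: `theorem foo : Summit.SmoothPoincare4.SmoothPoincare4.Theses.TwistorRealLines.<Decl> := …` in Summits/SmoothPoincare4/SmoothPoincare4/Theorems/<Name>.lean.
-/

namespace Summit.SmoothPoincare4.SmoothPoincare4.Theses.TwistorRealLines

open scoped BigOperators Topology Manifold Classical MeasureTheory ProbabilityTheory Matrix InnerProductSpace ComplexConjugate ContinuousMap ContDiff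
open Filter Set Function TopologicalSpace MeasureTheory

attribute [summit_statement] _root_.SmoothPoincare4

open Literature.SPC4 Literature.Geometry.Riemannian

/-- item stmt-SmoothPoincare4-5325 · target · rank 0 · open · by planner
why it might fail: E ⇔ SPC4 modulo FKP Conj 21 and R has no slack beyond SPC4; as a programme it stalls if real walls in ℂP³ are unavoidable (rank 2) or if Reznikov forms on ℂP³ are not standard (rank 5).
sources: FineKrasnovPanov2014, Reznikov1993, FinePanov2009, Hitchin1981
[target] X = E ∧ R: every smooth homotopy 4-sphere admits an orientation and a Riemannian metric of
positive twistor-symplectic type (framewise FKP inequality |Bᵀu| < |Au|, uᵀAu > 0 on o-positive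
orthonormal frames), and every smooth homotopy 4-sphere admitting one is diffeomorphic to S⁴. -/
@[route_item "route-SmoothPoincare4-TwistorRealLines"]
def Target : Prop :=
  (∀ (M : Type) [TopologicalSpace M] [T2Space M] [SecondCountableTopology M] [ChartedSpace (EuclideanSpace ℝ (Fin 4)) M] [IsManifold (𝓡 4) ∞ M], M ≃ₕ (Metric.sphere (0 : EuclideanSpace ℝ (Fin 5)) 1) → ∃ (o : Literature.Topology.FourManifolds.SmoothOrientation (𝓡 4) M) (g : Literature.Geometry.Lorentzian.PseudoRiemannianMetric (𝓡 4) ∞ (EuclideanSpace ℝ (Fin 4)) (TangentSpace (𝓡 4) : M → Type _)), ∃ _ : g.HasLeviCivita, g.IsRiemannian ∧ ∀ (x : M) (e : Fin 4 → TangentSpace (𝓡 4) x), g.IsOrthonormalFrame x e → 0 < Module.Ray.someVector (o x) (fun i => e (Fin.cast finrank_euclideanSpace_fin i)) → ∀ u : Fin 3 → ℝ, u ≠ 0 → dotProduct (Matrix.vecMul u (g.blockB g.leviCivita x e)) (Matrix.vecMul u (g.blockB g.leviCivita x e)) < dotProduct (Matrix.mulVec (g.blockA g.leviCivita x e) u)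 (Matrix.mulVec (g.blockA g.leviCivita x e) u) ∧ 0 < dotProduct u (Matrix.mulVec (g.blockA g.leviCivita x e) u)) ∧ (∀ (M : Type) [TopologicalSpace M] [T2Space M] [SecondCountableTopology M] [ChartedSpace (EuclideanSpace ℝ (Fin 4)) M] [IsManifold (𝓡 4) ∞ M], M ≃ₕ (Metric.sphere (0 : EuclideanSpace ℝ (Fin 5)) 1) → (∃ (o : Literature.Topology.FourManifolds.SmoothOrientation (𝓡 4) M) (g : Literature.Geometry.Lorentzian.PseudoRiemannianMetric (𝓡 4) ∞ (EuclideanSpace ℝ (Fin 4)) (TangentSpace (𝓡 4) : M → Type _)), ∃ _ : g.HasLeviCivita, g.IsRiemannian ∧ ∀ (x : M) (e : Fin 4 → TangentSpace (𝓡 4) x), g.IsOrthonormalFrame x e → 0 < Module.Ray.someVector (o x) (fun i => e (Fin.cast finrank_euclideanSpace_fin i)) → ∀ u : Fin 3 → ℝ, u ≠ 0 → dotProduct (Matrix.vecMul u (g.blockB g.leviCivita x e)) (Matrix.vecMul u (g.blockB g.leviCivita x e)) < dotProduct (Matrix.mulVec (g.blockA g.leviCivita x e) u) (Matrix.mulVec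 (g.blockA g.leviCivita x e) u) ∧ 0 < dotProduct u (Matrix.mulVec (g.blockA g.leviCivita x e) u)) → Nonempty (M ≃ₘ⟮𝓡 4, 𝓡 4⟯ (Metric.sphere (0 : EuclideanSpace ℝ (Fin 5)) 1)))

/-- item stmt-SmoothPoincare4-6745 · crux · rank 2 · open · by planner
why it might fail: Real J-lines are not automatically regular in dimension 6 (HLS is 4-dimensional); obstructed τ₀-real lines form codimension-1 walls among real tame J, so no wall-free path to J₀ need exist and a wall changes the leaf space by a cobordism; even at J₀ print has the base only up to homeomorphism.
sources: Gromov1985, HoferLizanSikorav1997, Welschinger2005, GeorgievaZinger2018, BrugalleGeorgieva2016, Hitchin1981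
[crux] RealCongruenceRigidity (card twistor-real-lines-cp3 item T3, sharpened from 'no real walls'
to its output; rank 2 = the route's ENGINE). Let ω_FS be the Fubini–Study form on ℂP³ =
Literature.Topology.FourManifolds.ComplexProjectiveSpace 3, τ₀[z₀:z₁:z₂:z₃] = [−z̄₁ : z̄₀ : −z̄₃ :
z̄₂] the free anti-holomorphic anti-symplectic involution (right multiplication by the quaternion
j), and J a SMOOTH ω_FS-tame almost complex structure on ℂP³ with dτ₀ ∘ J = −J ∘ dτ₀ (τ₀-real J).
Suppose p : ℂP³ → B is a smooth surjective submersion onto a smooth 4-manifold B (T2, second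
countable, ℝ⁴-charted, C^∞) with p ∘ τ₀ = p and J(ker dp_z) = ker dp_z for all z (the fibres are
τ₀-invariant embedded J-holomorphic spheres, necessarily in the line class: 'a τ₀-real J-line
congruence'). CLAIM: B is diffeomorphic to S⁴ (Nonempty (B ≃ₘ⟮𝓡 4, 𝓡 4⟯ S⁴)). Model: J = J₀ ⇒ the
τ₀-invariant complex lines are exactly the fibres of ℂP³ → ℍP¹ and B = S⁴; integrable J ⇒
Hitchin1981 (Kählerian twistor spaces). Intended proof: B ≅ the component through the fibres of the
moduli space M_R(J) of τ₀-invariant unparametrised J-lines (real index 4 = dimension of the family,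
so regular iff no other real deformations); jo -/
@[route_item "route-SmoothPoincare4-TwistorRealLines"]
def RealCongruenceRigidity : Prop :=
  open Literature.Topology.FourManifolds Literature.Geometry.Symplectic Literature.Geometry.Kaehler in ∀ (J : AlmostComplexStructure (𝓡 (2 * 3)) ∞ (ComplexProjectiveSpace 3)), J.IsTamedBy (fubiniStudyMFormCP 3) → ContMDiff (𝓡 (2 * 3)) (𝓡 (2 * 3)) ∞ (⇑(QuaternionicRealStructure 1) : ComplexProjectiveSpace 3 → ComplexProjectiveSpace 3) → (∀ (z : ComplexProjectiveSpace 3) (v : TangentSpace (𝓡 (2 * 3)) z), mfderiv (𝓡 (2 * 3)) (𝓡 (2 * 3)) (⇑(QuaternionicRealStructure 1) : ComplexProjectiveSpace 3 → ComplexProjectiveSpace 3) z (J z v) = -(J (QuaternionicRealStructure 1 z) (mfderiv (𝓡 (2 * 3)) (𝓡 (2 * 3)) (⇑(QuaternionicRealStructure 1) : ComplexProjectiveSpace 3 → ComplexProjectiveSpace 3) z v))) → ∀ (B : Type) [TopologicalSpace B] [T2Space B] [SecondCountableTopology B] [ChartedSpace (EuclideanSpace ℝ (Fin 4)) B] [IsManifold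 (𝓡 4) ∞ B] (p : ComplexProjectiveSpace 3 → B), ContMDiff (𝓡 (2 * 3)) (𝓡 4) ∞ p → Function.Surjective p → (∀ z, Function.Surjective (mfderiv (𝓡 (2 * 3)) (𝓡 4) p z)) → (∀ z, p (QuaternionicRealStructure 1 z) = p z) → (∀ (z : ComplexProjectiveSpace 3) (v : TangentSpace (𝓡 (2 * 3)) z), mfderiv (𝓡 (2 * 3)) (𝓡 4) p z v = 0 → mfderiv (𝓡 (2 * 3)) (𝓡 4) p z (J z v) = 0) → (∀ x : B, Nonempty (↥(p ⁻¹' {x}) ≃ₜ (Metric.sphere (0 : EuclideanSpace ℝ (Fin 3)) 1))) → Nonempty (B ≃ₘ⟮𝓡 4, 𝓡 4⟯ (Metric.sphere (0 : EuclideanSpace ℝ (Fin 5)) 1))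

/-- item stmt-SmoothPoincare4-5326 · crux · rank 3 · open · by planner
why it might fail: SPC4-complete mod FKP Conj 21 (an exotic Σ refutes it); s-dominated pointwise cone (PSC-hard: KumarSen2025) on a closed Σ reached from S⁴ only by codim-2/3 surgery, where pointwise curvature cones do not propagate (Hoelzel2016); no construction but a diffeomorphism is known.
sources: FineKrasnovPanov2014, Reznikov1993, FinePanov2009, Fine2017, Hoelzel2016, KumarSen2025
[crux] card item T1, in FKP's Riemannian form: for every smooth 4-manifold M (T2, second countable,
ℝ⁴-charted, C^∞) homotopy equivalent to S⁴ there are a smooth orientation o and a Riemannian metric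
g with Levi-Civita connection such that at every point x, for every g-orthonormal frame e that is
o-positive (some representative 4-form of o(x) is positive on e) and every u ∈ ℝ³ ∖ 0, |u ᵥ*
blockB|² < |blockA *ᵥ u|² and uᵀ(blockA)u > 0 (Hamilton's blocks A_ij = R(φᵢ,φⱼ), B_ij = R(φᵢ,ψⱼ) in
the self-dual/anti-self-dual bases of e; frame-independent within the orientation class).
Equivalently (s/12 + W⁺)² > Ric₀*Ric₀ and s/12 + W⁺ > 0: the Levi-Civita connection on Λ⁺ is
positive definite (FKP Thm 20), Z(M,g) is Reznikov-symplectic and Fano (FKP Prop 15). SPC4 ⇒ this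
(round metric: B = 0, A = (s/12)·c·Id > 0). [difficulty: open-problem] -/
@[route_item "route-SmoothPoincare4-TwistorRealLines", crux]
def TwistorSymplecticExistence : Prop :=
  ∀ (M : Type) [TopologicalSpace M] [T2Space M] [SecondCountableTopology M] [ChartedSpace (EuclideanSpace ℝ (Fin 4)) M] [IsManifold (𝓡 4) ∞ M], M ≃ₕ (Metric.sphere (0 : EuclideanSpace ℝ (Fin 5)) 1) → ∃ (o : Literature.Topology.FourManifolds.SmoothOrientation (𝓡 4) M) (g : Literature.Geometry.Lorentzian.PseudoRiemannianMetric (𝓡 4) ∞ (EuclideanSpace ℝ (Fin 4)) (TangentSpace (𝓡 4) : M → Type _)), ∃ _ : g.HasLeviCivita, g.IsRiemannian ∧ ∀ (x : M) (e : Fin 4 → TangentSpace (𝓡 4) x), g.IsOrthonormalFrame x e → 0 < Module.Ray.someVector (o x) (fun i => e (Fin.cast finrank_euclideanSpace_fin i)) → ∀ u : Fin 3 → ℝ, u ≠ 0 → dotProduct (Matrix.vecMul u (g.blockB g.leviCivita x e)) (Matrix.vecMul u (g.blockB g.leviCivita x e)) < dotProduct (Matrix.mulVec (g.blockA g.leviCivita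 x e) u) (Matrix.mulVec (g.blockA g.leviCivita x e) u) ∧ 0 < dotProduct u (Matrix.mulVec (g.blockA g.leviCivita x e) u)

/-- item stmt-SmoothPoincare4-5327 · crux · rank 4 · open · by planner
why it might fail: No slack: with Conj 19/21 it IS SPC4 on such Σ; engines are FKP's variational Conj 24 (no compactness for definite connections) or this route's real-line path, whose walls (obstructed τ-real lines, codimension 1 among real tame J) may be unavoidable in dimension 6.
sources: FineKrasnovPanov2014, Hitchin1981, Gromov1985, HoferLizanSikorav1997, Fine2017, Welschinger2005
[crux] FKP Conjecture 21 restricted to homotopy spheres (card: T2 ∧ T3 ∧ dictionary, umbrella form):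
every smooth 4-manifold M homotopy equivalent to S⁴ that carries an orientation o and a Riemannian
metric g of positive twistor-symplectic type (same framewise inequality as
TwistorSymplecticExistence) is diffeomorphic to S⁴. Intended proof = the route's engine:
TwistorToStandard → RealCongruenceRigidity (foreseen glued split); alternative engine = FKP Conj 24
(sibling card definite-connection-volume-ceiling). Known strata: Einstein (FKP Thm 22 via Gursky +
Hitchin1981), anti-self-dual (Hitchin1981), Fubini–Study-Riemannian-submersion twistor fibrations
(Gromoll–Grove). [difficulty: open-problem] -/
@[route_item "route-SmoothPoincare4-TwistorRealLines", crux]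
def TwistorSymplecticRigidity : Prop :=
  ∀ (M : Type) [TopologicalSpace M] [T2Space M] [SecondCountableTopology M] [ChartedSpace (EuclideanSpace ℝ (Fin 4)) M] [IsManifold (𝓡 4) ∞ M], M ≃ₕ (Metric.sphere (0 : EuclideanSpace ℝ (Fin 5)) 1) → (∃ (o : Literature.Topology.FourManifolds.SmoothOrientation (𝓡 4) M) (g : Literature.Geometry.Lorentzian.PseudoRiemannianMetric (𝓡 4) ∞ (EuclideanSpace ℝ (Fin 4)) (TangentSpace (𝓡 4) : M → Type _)), ∃ _ : g.HasLeviCivita, g.IsRiemannian ∧ ∀ (x : M) (e : Fin 4 → TangentSpace (𝓡 4) x), g.IsOrthonormalFrame x e → 0 < Module.Ray.someVector (o x) (fun i => e (Fin.cast finrank_euclideanSpace_fin i)) → ∀ u : Fin 3 → ℝ, u ≠ 0 → dotProduct (Matrix.vecMul u (g.blockB g.leviCivita x e)) (Matrix.vecMul u (g.blockB g.leviCivita x e)) < dotProduct (Matrix.mulVec (g.blockA g.leviCivita x e) u) (Matrix.mulVec (g.blockA g.leviCivita x e) u) ∧ 0 < dotProduct u (Matrix.mulVec (g.blockA g.leviCivita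 x e) u)) → Nonempty (M ≃ₘ⟮𝓡 4, 𝓡 4⟯ (Metric.sphere (0 : EuclideanSpace ℝ (Fin 5)) 1))

/-- item stmt-SmoothPoincare4-6761 · crux · rank 5 · open · by planner
why it might fail: Contains the open half of FKP Conj 19 — uniqueness of the symplectic form on ℂP³ in the class c[ω_FS] (open for ℂPⁿ, n ≥ 3) — plus τ-equivariance; a positive-type metric on S⁴ itself with non-standard (Z, ω_g, τ_g) refutes it without touching SPC4. Informal until defn-TwistorPackage lands.
sources: FineKrasnovPanov2014, FinePanov2009, Reznikov1993, Wall1966, McDuffSalamon2017, Gromov1985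
[crux] TwistorToStandard (card twistor-real-lines-cp3 item T2 'real-symplectic uniqueness', in the
fibred form the engine consumes; rank 5). Let M be a smooth 4-manifold homotopy equivalent to S⁴
with a smooth orientation o and a Riemannian metric g of positive twistor-symplectic type (exactly
the framewise inequality of item TwistorSymplecticExistence: |u ᵥ* blockB|² < |blockA *ᵥ u|² and uᵀ
blockA u > 0 on o-positive g-orthonormal frames, i.e. (s/12+W⁺)² > Ric₀*Ric₀ and s/12+W⁺ > 0). Let Z
= S(Λ⁺M) → M be the twistor space, ω_g Reznikov's closed coupling 2-form (curvature form of the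
vertical line bundle: vertical part = fibre area form, horizontal part z ↦ ⟨R(·,·)z, z⟩; SYMPLECTIC
by FinePanov2009 Lemma / FineKrasnovPanov2014 Lemma 12 + Thm 20 because the Levi-Civita connection
on Λ⁺ is positive definite; (Z, ω_g) is a symplectic Fano, FKP Prop 15), and τ_g : Z → Z the
fibrewise antipodal map (free involution, fibre-preserving, τ_g*ω_g = −ω_g). CLAIM: there are c > 0
and a diffeomorphism Φ : Z → ℂP³ = ComplexProjectiveSpace 3 with Φ*ω_FS = c·ω_g and Φ ∘ τ_g = τ₀ ∘
Φ, τ₀[z₀:z₁:z₂:z₃] = [−z̄₁ : z̄₀ : −z̄₃ : z̄₂] (equivalently: the real symplectic manifold (Z, ω_g,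
τ_g) is equivaria -/
@[route_item "route-SmoothPoincare4-TwistorRealLines"]
def TwistorToStandard : Prop :=
  open Literature.Topology.FourManifolds Literature.Geometry.Kaehler Literature.Geometry.Riemannian Literature.Geometry.Lorentzian in ∀ (M : Type) [TopologicalSpace M] [T2Space M] [SecondCountableTopology M] [ChartedSpace (EuclideanSpace ℝ (Fin 4)) M] [IsManifold (𝓡 4) ∞ M], M ≃ₕ (Metric.sphere (0 : EuclideanSpace ℝ (Fin 5)) 1) → ∀ (o : SmoothOrientation (𝓡 4) M) (g : PseudoRiemannianMetric (𝓡 4) ∞ (EuclideanSpace ℝ (Fin 4)) (TangentSpace (𝓡 4) : M → Type _)) [g.HasLeviCivita], g.IsRiemannian → (∀ (x : M) (e : Fin 4 → TangentSpace (𝓡 4) x), g.IsOrthonormalFrame x e → 0 < Module.Ray.someVector (o x) (fun i => e (Fin.cast finrank_euclideanSpace_fin i)) → ∀ u : Fin 3 → ℝ, u ≠ 0 → dotProduct (Matrix.vecMul u (g.blockB g.leviCivita x e)) (Matrix.vecMul u (g.blockB g.leviCivita x e)) < dotProduct (Matrix.mulVec (g.blockA g.leviCivita x e) u) (Matrix.mulVec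 (g.blockA g.leviCivita x e) u) ∧ 0 < dotProduct u (Matrix.mulVec (g.blockA g.leviCivita x e) u)) → ∀ (P : TwistorPackage M), IsTwistorSpaceOf g o P → ∃ c : ℝ, 0 < c ∧ ∃ Φ : P.Z ≃ₘ⟮𝓡 6, 𝓡 (2 * 3)⟯ ComplexProjectiveSpace 3, (fubiniStudyMFormCP 3).pullback (𝓡 6) Φ = c • P.omega ∧ ∀ z, Φ (P.tau z) = QuaternionicRealStructure 1 (Φ z)

/-- item stmt-SmoothPoincare4-5328 · support · rank 9 · open · by planner
sources: Wall1966, AtiyahHitchinSinger1978, KervaireMilnor1963, MilnorHCobordism1965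
[support] card step 1 (LIFT): every smooth 4-manifold M homotopy equivalent to S⁴ is the base of a
smooth S²-fibration of ℂP³ — there is a smooth surjective submersion p : ComplexProjectiveSpace 3 →
M (Literature's ℂP³, model 𝓡 (2·3)) all of whose fibres are homeomorphic to S². Proof route: the
twistor fibration S(Λ⁺M) → M of any metric composed with a diffeomorphism S(Λ⁺M) ≅ ℂP³, from
Wall1966 (closed 1-connected spin 6-manifolds with torsion-free homology are classified by H², the
cubic form and p₁: here ℤx, x³ = 1, p₁ = 4x², b₃ = 0) or from the S²-bundle over the h-cobordism Σ ∼
S⁴ (tree facts isHCobordant_sphere_of_homotopySphere_four,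
nonempty_diffeomorph_of_isHCobordant_of_five_le in dimension 6). SPC4 ⇒ this trivially (ℂP³ → ℍP¹ =
S⁴ ≅ M). [difficulty: L] -/
@[route_item "route-SmoothPoincare4-TwistorRealLines"]
def TwistorLift : Prop :=
  ∀ (M : Type) [TopologicalSpace M] [T2Space M] [SecondCountableTopology M] [ChartedSpace (EuclideanSpace ℝ (Fin 4)) M] [IsManifold (𝓡 4) ∞ M], M ≃ₕ (Metric.sphere (0 : EuclideanSpace ℝ (Fin 5)) 1) → ∃ p : Literature.Topology.FourManifolds.ComplexProjectiveSpace 3 → M, ContMDiff (𝓡 (2 * 3)) (𝓡 4) ∞ p ∧ Function.Surjective p ∧ (∀ z, Function.Surjective (mfderiv (𝓡 (2 * 3)) (𝓡 4) p z)) ∧ ∀ x : M, Nonempty (↥(p ⁻¹' {x}) ≃ₜ (Metric.sphere (0 : EuclideanSpace ℝ (Fin 3)) 1))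

/-- item stmt-SmoothPoincare4-5329 · support · rank 9 · open · by planner
sources: Hatcher2002, Whitehead1949, MilnorStasheff1974, Besse1987
[support] converse bookkeeping of step 1: if p : ComplexProjectiveSpace 3 → B is a smooth surjective
submersion onto a smooth 4-manifold B (T2, second countable) with fibres homeomorphic to S², then B
≃ₕ S⁴ (B is compact as an image; Ehresmann ⇒ fibre bundle; LES ⇒ π₁B = 1; χ(B) = χ(ℂP³)/χ(S²) = 2 ⇒
H₂B = 0; Hurewicz + Whitehead). Makes RealCongruenceRigidity's conclusion meaningful for SPC4 and
shows every positive item of the route is implied by SPC4. [difficulty: L] -/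
@[route_item "route-SmoothPoincare4-TwistorRealLines"]
def SphereFibrationBase : Prop :=
  ∀ (B : Type) [TopologicalSpace B] [T2Space B] [SecondCountableTopology B] [ChartedSpace (EuclideanSpace ℝ (Fin 4)) B] [IsManifold (𝓡 4) ∞ B] (p : Literature.Topology.FourManifolds.ComplexProjectiveSpace 3 → B), ContMDiff (𝓡 (2 * 3)) (𝓡 4) ∞ p → Function.Surjective p → (∀ z, Function.Surjective (mfderiv (𝓡 (2 * 3)) (𝓡 4) p z)) → (∀ x : B, Nonempty (↥(p ⁻¹' {x}) ≃ₜ (Metric.sphere (0 : EuclideanSpace ℝ (Fin 3)) 1))) → Nonempty (B ≃ₕ (Metric.sphere (0 : EuclideanSpace ℝ (Fin 5)) 1))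

/-- item stmt-SmoothPoincare4-5330 · support · rank 9 · open · by planner
sources: Wall1966, Hitchin1981
[support] the card's reformulation, as glue over the two supports: TwistorLift → SphereFibrationBase
→ (("every smooth S²-fibration p : ℂP³ → B over a smooth 4-manifold has B ≅ S⁴") ↔ SmoothPoincare4).
Pure logic (proved sorry-free in the planner's Sketch.lean, `fibrationReformulation_provable`).
[difficulty: provable-now] -/
@[route_item "route-SmoothPoincare4-TwistorRealLines"]
def FibrationReformulation : Prop :=
  TwistorLift → SphereFibrationBase → ((∀ (B : Type) [TopologicalSpace B] [T2Space B] [SecondCountableTopology B] [ChartedSpace (EuclideanSpace ℝ (Fin 4)) B] [IsManifold (𝓡 4) ∞ B] (p : Literature.Topology.FourManifolds.ComplexProjectiveSpace 3 → B), ContMDiff (𝓡 (2 * 3)) (𝓡 4) ∞ p → Function.Surjective p → (∀ z, Function.Surjective (mfderiv (𝓡 (2 * 3)) (𝓡 4) p z)) → (∀ x : B, Nonempty (↥(p ⁻¹' {x}) ≃ₜ (Metric.sphere (0 : EuclideanSpace ℝ (Fin 3)) 1))) → Nonempty (B ≃ₘ⟮𝓡 4, 𝓡 4⟯ (Metric.sphere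 (0 : EuclideanSpace ℝ (Fin 5)) 1))) ↔ SmoothPoincare4)

/-- item stmt-SmoothPoincare4-5331 · assembly · rank 1 · open · by planner
sources: FineKrasnovPanov2014, Kirby1997
[assembly] TwistorSymplecticRigidity → TwistorSymplecticExistence → SmoothPoincare4. -/
@[route_item "route-SmoothPoincare4-TwistorRealLines"]
def Assembly : Prop :=
  TwistorSymplecticRigidity → TwistorSymplecticExistence → SmoothPoincare4

/-! D-0027 §2.1 — DECIDING THEOREM (planner-authored via `route open/edit --closes-file`; by planner-rbadge-SmoothPoincare4-TwistorRealLine-d095f5be-g2-0 2026-08-15T16:21:13Z):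
its hypotheses are this route's items and its conclusion the sub-problem Statement (glue_lint), and it elaborates with this file. -/

@[closes "route-SmoothPoincare4-TwistorRealLines"] theorem closes (hR : TwistorSymplecticRigidity) (hE : TwistorSymplecticExistence) :
    _root_.SmoothPoincare4 := by
  unfold _root_.SmoothPoincare4 Literature.SPC4.SmoothPoincareConjectureFour
    ContinuousMap.HomotopyEquiv.NonemptyDiffeomorphSphere
  intro M _ _ _ _ _ he
  exact hR M he (hE M he)

end Summit.SmoothPoincare4.SmoothPoincare4.Theses.TwistorRealLines
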